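import Summits.CriticalPhenomena.PercolationContinuityZ3.Theorems.FK.EdgeDensityContinuityCriterion
import Literature.Probability.LatticeModels.RandomClusterFiniteVolumePressure
import Mathlib.Analysis.Calculus.Deriv.Slope
import Mathlib.Analysis.SpecialFunctions.Log.Deriv
import HarnessLib

/-!
# FK-continuity cell, FO-10a (pressure layer): the one-sided `p`-derivatives of the random-cluster pressure are
# `d (h¹(p,q) − p) / (p(1−p))` and `d (h⁰(p,q) − p) / (p(1−p))`; the pressure is differentiable at `p` iff `φ⁰_{p,q} = φ¹_{p,q}`
# — Grimmett 2006, Thm. (4.63) (a) ⟺ (c) ⟺ (d), with (4.76)–(4.77)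

Registered R84 (cell INBOX l.6112, 2026-08-24); registry row FO-10a-g338d; label PRS-G (coordinator fk-4 g187).
Cell `fk-continuity` (bschramm), row FO-10a (domain-Markov + comparison layer over FO-06); support file for the
FK-continuity transplant (`--supports stmt-CriticalPhenomena-4575`); builds on p205010 (kernel theorem, internal audit
signed; external expert review pending). Pure proofs; no definitions, no named facts, no sorries; general `d`.
UNCONDITIONAL infinite-volume structure; it decides nothing about FH / TP_FK / the value of `p_c(q)`.

Let `q ≥ 1` and let `Φ : ℝ → ℝ` be the per-site pressure of the random-cluster model on `ℤ^d` along boxes, i.e. any function with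
`|Λ_N|⁻¹ log Z^b_{Λ_N}(x,q) → Φ(x)` for `x ∈ (0,1)` and both boundary conditions `b` (it exists and `b` does not matter:
`PressureThermodynamicLimit.exists_forall_tendsto_log_rcPartitionFunction_box_div`, Grimmett 2006 Thm. (4.58)); the present file takes
`Φ`, the edge count `|E_{Λ_N}|/|Λ_N| → d` and the mean edge densities `|Λ_N|⁻¹ E^b_{Λ_N,x,q}|ω| → d h^b(x,q)` (`LatticeEdgeCounting.lean`,
`PressureEdgeDensity.lean`) as HYPOTHESES `hΦ`, `hE`, `h0`, `h1`, so that it depends on built modules only; the capstone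
`PressureUniquenessCriterion.lean` discharges them. With `h⁰ = freeEdgeDensity d · q e₀`, `h¹ = wiredEdgeDensity d · q e₀` (Literature
`RandomClusterShiftedBoxes.lean`; Grimmett's `h^b(p,q)`, (4.61)) and `p ∈ (0,1)`:

* `sub_le_pressure_sub` — the tangent inequality in the limit (from Literature `log_rcPartitionFunction_sub_ge`, Jensen / convexity of
  `log Y_Λ` in `π = log(p/(1-p))`, Grimmett (4.72)–(4.73)): `Φ(y) − Φ(x) ≥ d [log(y/x) h^b(x) + log((1−y)/(1−x)) (1 − h^b(x))]`;
  `pressure_sub_le_sub` — the same read from `y`;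
* `tendsto_slope_log`, `tendsto_slope_log_one_sub` — `(log y − log p)/(y − p) → 1/p`, `(log(1−y) − log(1−p))/(y − p) → −1/(1−p)`;
* **`hasDerivWithinAt_pressure_Ioi`**: `Φ'(p+) = d (h¹(p,q) − p)/(p(1−p))` (lower bound: wired tangent at `p`; upper bound: free tangent at
  `y ↓ p` with `h⁰(y) → h¹(p)`, LHT-A `tendsto_freeEdgeDensity_nhdsGT`) — Grimmett's (4.77) `dG/dπ⁺ = φ¹_{p,q}(J_e)` in the `p`-chart;
* **`hasDerivWithinAt_pressure_Iio`**: `Φ'(p−) = d (h⁰(p,q) − p)/(p(1−p))` (symmetrically, `h¹(y) → h⁰(p)` as `y ↑ p`);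
* **`differentiableAt_pressure_iff_edgeDensity_eq`**: `Φ` differentiable at `p` ⟺ `h⁰(p,q) = h¹(p,q)` (Thm. (4.63) (a) ⟺ (c));
* **`differentiableAt_pressure_iff_rcLimit_eq`**: ⟺ `φ⁰_{p,q} = φ¹_{p,q}` (Thm. (4.63) (a) ⟺ (d), via FO-07b
  `rcLimit_false_eq_rcLimit_true_iff_of_mem_edgeSet`).

Chart note (honest framing): Grimmett's `G(π,κ) = Φ/d − log(1−p)` with `π = log(p/(1−p))`; `dG/dπ^± = h^{1/0}` ⟺ `dΦ/dp^± = d(h^{1/0} − p)/(p(1−p))`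
(`dπ/dp = 1/(p(1−p))`, `d/dp[−log(1−p)] = 1/(1−p)`). Convexity of `G` is not used: the one-sided derivatives come from the two tangent
inequalities and the one-sided limits of `h⁰, h¹` (Prop. (4.28), Thm. (4.63)(b)). NOT a binder discharge, NOT `_r4`; no statement about `p_c(q)`.

## References

* G. Grimmett, *The Random-Cluster Model*, Springer 2006 (`book:grimmett2006-random-cluster-model`): §4.5, Thm. (4.58), (4.61)–(4.63),
  proof of Thm. (4.63), (4.72)–(4.78) [PDF pp. 88–93]. [Grimmett2006]
-/

noncomputable section

open Finset Filter Topology Set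

namespace Summit.CriticalPhenomena.PercolationContinuityZ3.Theorems.FK

open Literature.Probability.Percolation Literature.Probability.LatticeModels

variable {d : ℕ} {q : ℝ} {e₀ : Sym2 (Site d)} {Φ : ℝ → ℝ}

/-! ### The tangent inequality in the thermodynamic limit -/

section Tangent

/-- **The tangent inequality of the pressure** (Grimmett 2006, (4.72)–(4.73): convexity of the finite-volume pressure in `π`, with
`π`-derivative the mean edge density; in the limit with Literature `log_rcPartitionFunction_sub_ge` and the mean-density limit
`|Λ_N|⁻¹ E^b_{Λ_N,x,q}|ω| → d·h`): if `|Λ_N|⁻¹ log Z^b_{Λ_N}(·,q) → Φ` at `x` and `y`, `|E_{Λ_N}|/|Λ_N| → d` and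
`|Λ_N|⁻¹ E^b_{Λ_N,x,q}|ω| → d h`, then `d (log(y/x) h + log((1−y)/(1−x)) (1 − h)) ≤ Φ(y) − Φ(x)`.
[cite: Grimmett2006, proof of Thm. (4.58) (convexity) and (4.72)–(4.75)] -/
theorem sub_le_pressure_sub (hq : 0 < q) {b : Bool} {x y h : ℝ} (hx : x ∈ Set.Ioo (0 : ℝ) 1) (hy : y ∈ Set.Ioo (0 : ℝ) 1)
    (hΦx : Tendsto (fun N : ℕ =>
      Real.log (rcPartitionFunction (finsetGraph (zdGraph d) (box d N)) x q (boxBC d b N)) / #(box d N)) atTop (𝓝 (Φ x)))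
    (hΦy : Tendsto (fun N : ℕ =>
      Real.log (rcPartitionFunction (finsetGraph (zdGraph d) (box d N)) y q (boxBC d b N)) / #(box d N)) atTop (𝓝 (Φ y)))
    (hE : Tendsto (fun N : ℕ => (#(finsetGraph (zdGraph d) (box d N)).edgeFinset : ℝ) / #(box d N)) atTop (𝓝 (d : ℝ)))
    (hM : Tendsto (fun N : ℕ =>
      rcExpect (finsetGraph (zdGraph d) (box d N)) x q (boxBC d b N) (fun ω => (#ω : ℝ)) / #(box d N)) atTop (𝓝 (d * h))) :
    d * (Real.log (y / x) * h + Real.log ((1 - y) / (1 - x)) * (1 - h)) ≤ Φ y - Φ x := by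
  have hlim1 : Tendsto (fun N : ℕ =>
      (Real.log (y / x) * rcExpect (finsetGraph (zdGraph d) (box d N)) x q (boxBC d b N) (fun ω => (#ω : ℝ)) +
        Real.log ((1 - y) / (1 - x)) * ((#(finsetGraph (zdGraph d) (box d N)).edgeFinset : ℝ) -
          rcExpect (finsetGraph (zdGraph d) (box d N)) x q (boxBC d b N) (fun ω => (#ω : ℝ)))) / #(box d N)) atTop
      (𝓝 (Real.log (y / x) * (d * h) + Real.log ((1 - y) / (1 - x)) * (d - d * h))) := by
    have h := (hM.const_mul (Real.log (y / x))).add ((hE.sub hM).const_mul (Real.log ((1 - y) / (1 - x))))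
    refine h.congr fun N => ?_
    simp only [add_div, mul_div_assoc, sub_div]
  have hlim2 : Tendsto (fun N : ℕ =>
      (Real.log (rcPartitionFunction (finsetGraph (zdGraph d) (box d N)) y q (boxBC d b N)) -
        Real.log (rcPartitionFunction (finsetGraph (zdGraph d) (box d N)) x q (boxBC d b N))) / #(box d N)) atTop
      (𝓝 (Φ y - Φ x)) := by
    refine (hΦy.sub hΦx).congr fun N => ?_
    rw [sub_div]
  have hle := le_of_tendsto_of_tendsto' hlim1 hlim2 fun N => by
    have hpos : (0 : ℝ) < #(box d N) := by exact_mod_cast Finset.card_pos.2 (box_nonempty d N)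
    exact div_le_div_of_nonneg_right (log_rcPartitionFunction_sub_ge _ hx hy hq (boxBC d b N)) hpos.le
  calc (d : ℝ) * (Real.log (y / x) * h + Real.log ((1 - y) / (1 - x)) * (1 - h))
      = Real.log (y / x) * (d * h) + Real.log ((1 - y) / (1 - x)) * (d - d * h) := by ring
    _ ≤ Φ y - Φ x := hle

/-- The tangent inequality read from the other endpoint: under the same hypotheses AT `y`,
`Φ(y) − Φ(x) ≤ d (log(y/x) h + log((1−y)/(1−x)) (1 − h))` where now `d h = lim |Λ_N|⁻¹ E^b_{Λ_N,y,q}|ω|`.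
[cite: Grimmett2006, proof of Thm. (4.58) (convexity) and (4.72)–(4.75)] -/
theorem pressure_sub_le_sub (hq : 0 < q) {b : Bool} {x y h : ℝ} (hx : x ∈ Set.Ioo (0 : ℝ) 1) (hy : y ∈ Set.Ioo (0 : ℝ) 1)
    (hΦx : Tendsto (fun N : ℕ =>
      Real.log (rcPartitionFunction (finsetGraph (zdGraph d) (box d N)) x q (boxBC d b N)) / #(box d N)) atTop (𝓝 (Φ x)))
    (hΦy : Tendsto (fun N : ℕ =>
      Real.log (rcPartitionFunction (finsetGraph (zdGraph d) (box d N)) y q (boxBC d b N)) / #(box d N)) atTop (𝓝 (Φ y)))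
    (hE : Tendsto (fun N : ℕ => (#(finsetGraph (zdGraph d) (box d N)).edgeFinset : ℝ) / #(box d N)) atTop (𝓝 (d : ℝ)))
    (hM : Tendsto (fun N : ℕ =>
      rcExpect (finsetGraph (zdGraph d) (box d N)) y q (boxBC d b N) (fun ω => (#ω : ℝ)) / #(box d N)) atTop (𝓝 (d * h))) :
    Φ y - Φ x ≤ d * (Real.log (y / x) * h + Real.log ((1 - y) / (1 - x)) * (1 - h)) := by
  have h' := sub_le_pressure_sub hq hy hx hΦy hΦx hE hM
  have e1 : Real.log (x / y) = -Real.log (y / x) := by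
    rw [← Real.log_inv, inv_div]
  have e2 : Real.log ((1 - x) / (1 - y)) = -Real.log ((1 - y) / (1 - x)) := by
    rw [← Real.log_inv, inv_div]
  rw [e1, e2] at h'
  linarith

end Tangent

/-! ### Slopes of `log` and `log (1 − ·)` -/

section Slopes

/-- `(log y − log p)/(y − p) → 1/p` as `y → p`, `y ≠ p` (`p ≠ 0`). [folklore] -/
theorem tendsto_slope_log {p : ℝ} (hp : p ≠ 0) : Tendsto (slope Real.log p) (𝓝[≠] p) (𝓝 p⁻¹) :=
  hasDerivAt_iff_tendsto_slope.1 (Real.hasDerivAt_log hp)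

/-- `(log(1−y) − log(1−p))/(y − p) → −1/(1−p)` as `y → p`, `y ≠ p` (`p ≠ 1`). [folklore] -/
theorem tendsto_slope_log_one_sub {p : ℝ} (hp : p ≠ 1) :
    Tendsto (slope (fun t : ℝ => Real.log (1 - t)) p) (𝓝[≠] p) (𝓝 (-(1 - p)⁻¹)) := by
  have h1 : HasDerivAt (fun t : ℝ => 1 - t) (-1) p := (hasDerivAt_id p).const_sub 1
  have h2 := h1.log (sub_ne_zero.2 (Ne.symm hp))
  rw [show (-1 : ℝ) / (1 - p) = -(1 - p)⁻¹ by rw [neg_div, one_div]] at h2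
  exact hasDerivAt_iff_tendsto_slope.1 h2

/-- For `0 < x, y`: `log(y/x) = slope log x y · (y − x)`. [folklore] -/
theorem log_div_eq_slope_mul {x y : ℝ} (hx : 0 < x) (hy : 0 < y) (hxy : x ≠ y) :
    Real.log (y / x) = slope Real.log x y * (y - x) := by
  rw [slope_def_field, Real.log_div hy.ne' hx.ne', div_mul_cancel₀ _ (sub_ne_zero.2 hxy.symm)]

/-- For `x, y < 1`: `log((1−y)/(1−x)) = slope (log(1 − ·)) x y · (y − x)`. [folklore] -/
theorem log_div_one_sub_eq_slope_mul {x y : ℝ} (hx : x < 1) (hy : y < 1) (hxy : x ≠ y) :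
    Real.log ((1 - y) / (1 - x)) = slope (fun t : ℝ => Real.log (1 - t)) x y * (y - x) := by
  rw [slope_def_field, Real.log_div (sub_pos.2 hy).ne' (sub_pos.2 hx).ne', div_mul_cancel₀ _ (sub_ne_zero.2 hxy.symm)]

end Slopes

/-! ### One-sided derivatives of the pressure -/

section Derivatives

variable {p : ℝ}

/-- **Right derivative of the pressure: `Φ'(p+) = d (h¹(p,q) − p)/(p(1−p))`** (Grimmett 2006, (4.77): `dG/dπ⁺ = φ¹_{p,q}(J_e)`, in the
`p`-chart and per site). Hypotheses: `Φ` is the limit of the per-site box pressures for BOTH boundary conditions on `(0,1)` (Thm. (4.58)),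
`|E_{Λ_N}|/|Λ_N| → d`, and the mean edge densities converge, `|Λ_N|⁻¹ E⁰_{Λ_N,x,q}|ω| → d h⁰(x)`, `|Λ_N|⁻¹ E¹_{Λ_N,x,q}|ω| → d h¹(x)` on `(0,1)`.
Lower bound: the wired tangent inequality at `p`; upper bound: the free tangent inequality read at `y ↓ p` together with
`h⁰(y) → h¹(p)` (`tendsto_freeEdgeDensity_nhdsGT`). [cite: Grimmett2006, proof of Thm. (4.63), (4.76)–(4.78)] -/
theorem hasDerivWithinAt_pressure_Ioi (hp : p ∈ Set.Ioo (0 : ℝ) 1) (hq : 1 ≤ q) (he₀ : e₀ ∈ (zdGraph d).edgeSet)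
    (hΦ : ∀ b : Bool, ∀ x ∈ Set.Ioo (0 : ℝ) 1, Tendsto (fun N : ℕ =>
      Real.log (rcPartitionFunction (finsetGraph (zdGraph d) (box d N)) x q (boxBC d b N)) / #(box d N)) atTop (𝓝 (Φ x)))
    (hE : Tendsto (fun N : ℕ => (#(finsetGraph (zdGraph d) (box d N)).edgeFinset : ℝ) / #(box d N)) atTop (𝓝 (d : ℝ)))
    (h0 : ∀ x ∈ Set.Ioo (0 : ℝ) 1, Tendsto (fun N : ℕ =>
      rcExpect (finsetGraph (zdGraph d) (box d N)) x q (boxBC d false N) (fun ω => (#ω : ℝ)) / #(box d N)) atTop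
        (𝓝 (d * freeEdgeDensity d x q e₀)))
    (h1 : ∀ x ∈ Set.Ioo (0 : ℝ) 1, Tendsto (fun N : ℕ =>
      rcExpect (finsetGraph (zdGraph d) (box d N)) x q (boxBC d true N) (fun ω => (#ω : ℝ)) / #(box d N)) atTop
        (𝓝 (d * wiredEdgeDensity d x q e₀))) :
    HasDerivWithinAt Φ (d * (wiredEdgeDensity d p q e₀ - p) / (p * (1 - p))) (Set.Ioi p) p := by
  obtain ⟨i₀, -, -⟩ := exists_eq_map_add_of_mem_edgeSet he₀
  have hd : 0 < d := i₀.pos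
  have hq0 : 0 < q := one_pos.trans_le hq
  have hp0 : 0 < p := hp.1
  have hp1 : p < 1 := hp.2
  set H := wiredEdgeDensity d p q e₀ with hH
  -- the common limit of the two bounds
  have hD : d * (H - p) / (p * (1 - p)) = d * (p⁻¹ * H + -(1 - p)⁻¹ * (1 - H)) := by
    have hp0' : p ≠ 0 := hp0.ne'
    have hp1' : 1 - p ≠ 0 := (sub_pos.2 hp1).ne'
    field_simp
    ring
  rw [hasDerivWithinAt_iff_tendsto_slope' (show p ∉ Set.Ioi p from lt_irrefl p), hD]
  -- slopes of `log` and `log (1 − ·)` along `𝓝[>] p`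
  have hs1 : Tendsto (slope Real.log p) (𝓝[>] p) (𝓝 p⁻¹) :=
    (tendsto_slope_log hp0.ne').mono_left (nhdsGT_le_nhdsNE p)
  have hs2 : Tendsto (slope (fun t : ℝ => Real.log (1 - t)) p) (𝓝[>] p) (𝓝 (-(1 - p)⁻¹)) :=
    (tendsto_slope_log_one_sub hp1.ne).mono_left (nhdsGT_le_nhdsNE p)
  -- `h⁰(y) → h¹(p)` as `y ↓ p`
  have hh : Tendsto (fun y : ℝ => freeEdgeDensity d y q e₀) (𝓝[>] p) (𝓝 H) := tendsto_freeEdgeDensity_nhdsGT hd hp hq he₀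
  -- lower bound `L(y) = d (slope log p y · H + slope log(1−·) p y · (1 − H))`, upper bound with `h⁰(y)` in place of `H`
  have hL : Tendsto (fun y : ℝ => d * (slope Real.log p y * H + slope (fun t : ℝ => Real.log (1 - t)) p y * (1 - H))) (𝓝[>] p)
      (𝓝 (d * (p⁻¹ * H + -(1 - p)⁻¹ * (1 - H)))) :=
    ((hs1.mul_const H).add (hs2.mul_const (1 - H))).const_mul (d : ℝ)
  have hU : Tendsto (fun y : ℝ => d * (slope Real.log p y * freeEdgeDensity d y q e₀ +
      slope (fun t : ℝ => Real.log (1 - t)) p y * (1 - freeEdgeDensity d y q e₀))) (𝓝[>] p)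
      (𝓝 (d * (p⁻¹ * H + -(1 - p)⁻¹ * (1 - H)))) :=
    ((hs1.mul hh).add (hs2.mul (tendsto_const_nhds.sub hh))).const_mul (d : ℝ)
  refine tendsto_of_tendsto_of_tendsto_of_le_of_le' hL hU ?_ ?_
  · filter_upwards [Ioo_mem_nhdsGT hp1] with y hy
    have hy' : y ∈ Set.Ioo (0 : ℝ) 1 := ⟨hp0.trans hy.1, hy.2⟩
    have hne : p ≠ y := hy.1.ne
    have key := sub_le_pressure_sub (b := true) hq0 hp hy' (hΦ true p hp) (hΦ true y hy') hE (h1 p hp)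
    rw [log_div_eq_slope_mul hp0 hy'.1 hne, log_div_one_sub_eq_slope_mul hp1 hy'.2 hne] at key
    rw [slope_def_field Φ p y, le_div_iff₀ (sub_pos.2 hy.1)]
    calc d * (slope Real.log p y * H + slope (fun t : ℝ => Real.log (1 - t)) p y * (1 - H)) * (y - p)
        = d * (slope Real.log p y * (y - p) * H + slope (fun t : ℝ => Real.log (1 - t)) p y * (y - p) * (1 - H)) := by ring
      _ ≤ Φ y - Φ p := key
  · filter_upwards [Ioo_mem_nhdsGT hp1] with y hy
    have hy' : y ∈ Set.Ioo (0 : ℝ) 1 := ⟨hp0.trans hy.1, hy.2⟩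
    have hne : p ≠ y := hy.1.ne
    have key := pressure_sub_le_sub (b := false) hq0 hp hy' (hΦ false p hp) (hΦ false y hy') hE (h0 y hy')
    rw [log_div_eq_slope_mul hp0 hy'.1 hne, log_div_one_sub_eq_slope_mul hp1 hy'.2 hne] at key
    rw [slope_def_field Φ p y, div_le_iff₀ (sub_pos.2 hy.1)]
    calc Φ y - Φ p ≤ _ := key
      _ = d * (slope Real.log p y * freeEdgeDensity d y q e₀ +
          slope (fun t : ℝ => Real.log (1 - t)) p y * (1 - freeEdgeDensity d y q e₀)) * (y - p) := by ring

/-- **Left derivative of the pressure: `Φ'(p−) = d (h⁰(p,q) − p)/(p(1−p))`** (Grimmett 2006, (4.77): `dG/dπ⁻ = φ⁰_{p,q}(J_e)`, in the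
`p`-chart and per site), under the hypotheses of `hasDerivWithinAt_pressure_Ioi`. Upper bound: the free tangent inequality at `p`; lower
bound: the wired tangent inequality read at `y ↑ p` together with `h¹(y) → h⁰(p)` (`tendsto_wiredEdgeDensity_nhdsLT`).
[cite: Grimmett2006, proof of Thm. (4.63), (4.76)–(4.78)] -/
theorem hasDerivWithinAt_pressure_Iio (hp : p ∈ Set.Ioo (0 : ℝ) 1) (hq : 1 ≤ q) (he₀ : e₀ ∈ (zdGraph d).edgeSet)
    (hΦ : ∀ b : Bool, ∀ x ∈ Set.Ioo (0 : ℝ) 1, Tendsto (fun N : ℕ =>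
      Real.log (rcPartitionFunction (finsetGraph (zdGraph d) (box d N)) x q (boxBC d b N)) / #(box d N)) atTop (𝓝 (Φ x)))
    (hE : Tendsto (fun N : ℕ => (#(finsetGraph (zdGraph d) (box d N)).edgeFinset : ℝ) / #(box d N)) atTop (𝓝 (d : ℝ)))
    (h0 : ∀ x ∈ Set.Ioo (0 : ℝ) 1, Tendsto (fun N : ℕ =>
      rcExpect (finsetGraph (zdGraph d) (box d N)) x q (boxBC d false N) (fun ω => (#ω : ℝ)) / #(box d N)) atTop
        (𝓝 (d * freeEdgeDensity d x q e₀)))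
    (h1 : ∀ x ∈ Set.Ioo (0 : ℝ) 1, Tendsto (fun N : ℕ =>
      rcExpect (finsetGraph (zdGraph d) (box d N)) x q (boxBC d true N) (fun ω => (#ω : ℝ)) / #(box d N)) atTop
        (𝓝 (d * wiredEdgeDensity d x q e₀))) :
    HasDerivWithinAt Φ (d * (freeEdgeDensity d p q e₀ - p) / (p * (1 - p))) (Set.Iio p) p := by
  obtain ⟨i₀, -, -⟩ := exists_eq_map_add_of_mem_edgeSet he₀
  have hd : 0 < d := i₀.pos
  have hq0 : 0 < q := one_pos.trans_le hq
  have hp0 : 0 < p := hp.1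
  have hp1 : p < 1 := hp.2
  set H := freeEdgeDensity d p q e₀ with hH
  have hD : d * (H - p) / (p * (1 - p)) = d * (p⁻¹ * H + -(1 - p)⁻¹ * (1 - H)) := by
    have hp0' : p ≠ 0 := hp0.ne'
    have hp1' : 1 - p ≠ 0 := (sub_pos.2 hp1).ne'
    field_simp
    ring
  rw [hasDerivWithinAt_iff_tendsto_slope' (show p ∉ Set.Iio p from lt_irrefl p), hD]
  have hs1 : Tendsto (slope Real.log p) (𝓝[<] p) (𝓝 p⁻¹) :=
    (tendsto_slope_log hp0.ne').mono_left (nhdsLT_le_nhdsNE p)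
  have hs2 : Tendsto (slope (fun t : ℝ => Real.log (1 - t)) p) (𝓝[<] p) (𝓝 (-(1 - p)⁻¹)) :=
    (tendsto_slope_log_one_sub hp1.ne).mono_left (nhdsLT_le_nhdsNE p)
  -- `h¹(y) → h⁰(p)` as `y ↑ p`
  have hh : Tendsto (fun y : ℝ => wiredEdgeDensity d y q e₀) (𝓝[<] p) (𝓝 H) := tendsto_wiredEdgeDensity_nhdsLT hd hp hq he₀
  have hU : Tendsto (fun y : ℝ => d * (slope Real.log p y * H + slope (fun t : ℝ => Real.log (1 - t)) p y * (1 - H))) (𝓝[<] p)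
      (𝓝 (d * (p⁻¹ * H + -(1 - p)⁻¹ * (1 - H)))) :=
    ((hs1.mul_const H).add (hs2.mul_const (1 - H))).const_mul (d : ℝ)
  have hL : Tendsto (fun y : ℝ => d * (slope Real.log p y * wiredEdgeDensity d y q e₀ +
      slope (fun t : ℝ => Real.log (1 - t)) p y * (1 - wiredEdgeDensity d y q e₀))) (𝓝[<] p)
      (𝓝 (d * (p⁻¹ * H + -(1 - p)⁻¹ * (1 - H)))) :=
    ((hs1.mul hh).add (hs2.mul (tendsto_const_nhds.sub hh))).const_mul (d : ℝ)
  refine tendsto_of_tendsto_of_tendsto_of_le_of_le' hL hU ?_ ?_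
  · filter_upwards [Ioo_mem_nhdsLT hp0] with y hy
    have hy' : y ∈ Set.Ioo (0 : ℝ) 1 := ⟨hy.1, hy.2.trans hp1⟩
    have hne : p ≠ y := hy.2.ne'
    -- wired tangent inequality read from `y`: `Φ y − Φ p ≤ d(...)·`, divided by `y − p < 0`
    have key := pressure_sub_le_sub (b := true) hq0 hp hy' (hΦ true p hp) (hΦ true y hy') hE (h1 y hy')
    rw [log_div_eq_slope_mul hp0 hy'.1 hne, log_div_one_sub_eq_slope_mul hp1 hy'.2 hne] at key
    rw [slope_def_field Φ p y, le_div_iff_of_neg (sub_neg.2 hy.2)]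
    calc Φ y - Φ p ≤ _ := key
      _ = d * (slope Real.log p y * wiredEdgeDensity d y q e₀ +
          slope (fun t : ℝ => Real.log (1 - t)) p y * (1 - wiredEdgeDensity d y q e₀)) * (y - p) := by ring
  · filter_upwards [Ioo_mem_nhdsLT hp0] with y hy
    have hy' : y ∈ Set.Ioo (0 : ℝ) 1 := ⟨hy.1, hy.2.trans hp1⟩
    have hne : p ≠ y := hy.2.ne'
    -- free tangent inequality at `p`: `Φ y − Φ p ≥ d(...)`, divided by `y − p < 0`
    have key := sub_le_pressure_sub (b := false) hq0 hp hy' (hΦ false p hp) (hΦ false y hy') hE (h0 p hp)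
    rw [log_div_eq_slope_mul hp0 hy'.1 hne, log_div_one_sub_eq_slope_mul hp1 hy'.2 hne] at key
    rw [slope_def_field Φ p y, div_le_iff_of_neg (sub_neg.2 hy.2)]
    calc d * (slope Real.log p y * H + slope (fun t : ℝ => Real.log (1 - t)) p y * (1 - H)) * (y - p)
        = d * (slope Real.log p y * (y - p) * H + slope (fun t : ℝ => Real.log (1 - t)) p y * (y - p) * (1 - H)) := by ring
      _ ≤ Φ y - Φ p := key

/-- **Grimmett 2006, Thm. (4.63) (a) ⟺ (c): the pressure is differentiable at `p` iff `h⁰(p,q) = h¹(p,q)`** (the jump of the derivative is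
`d (h¹ − h⁰)/(p(1−p))`, (4.77)), under the hypotheses of `hasDerivWithinAt_pressure_Ioi`.
[cite: Grimmett2006, Thm. (4.63) ((a) ⟺ (c)) with (4.77)] -/
theorem differentiableAt_pressure_iff_edgeDensity_eq (hp : p ∈ Set.Ioo (0 : ℝ) 1) (hq : 1 ≤ q) (he₀ : e₀ ∈ (zdGraph d).edgeSet)
    (hΦ : ∀ b : Bool, ∀ x ∈ Set.Ioo (0 : ℝ) 1, Tendsto (fun N : ℕ =>
      Real.log (rcPartitionFunction (finsetGraph (zdGraph d) (box d N)) x q (boxBC d b N)) / #(box d N)) atTop (𝓝 (Φ x)))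
    (hE : Tendsto (fun N : ℕ => (#(finsetGraph (zdGraph d) (box d N)).edgeFinset : ℝ) / #(box d N)) atTop (𝓝 (d : ℝ)))
    (h0 : ∀ x ∈ Set.Ioo (0 : ℝ) 1, Tendsto (fun N : ℕ =>
      rcExpect (finsetGraph (zdGraph d) (box d N)) x q (boxBC d false N) (fun ω => (#ω : ℝ)) / #(box d N)) atTop
        (𝓝 (d * freeEdgeDensity d x q e₀)))
    (h1 : ∀ x ∈ Set.Ioo (0 : ℝ) 1, Tendsto (fun N : ℕ =>
      rcExpect (finsetGraph (zdGraph d) (box d N)) x q (boxBC d true N) (fun ω => (#ω : ℝ)) / #(box d N)) atTop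
        (𝓝 (d * wiredEdgeDensity d x q e₀))) :
    DifferentiableAt ℝ Φ p ↔ freeEdgeDensity d p q e₀ = wiredEdgeDensity d p q e₀ := by
  obtain ⟨i₀, -, -⟩ := exists_eq_map_add_of_mem_edgeSet he₀
  have hd : 0 < d := i₀.pos
  have hp0 : 0 < p := hp.1
  have hp1 : p < 1 := hp.2
  have hR := hasDerivWithinAt_pressure_Ioi hp hq he₀ hΦ hE h0 h1
  have hL := hasDerivWithinAt_pressure_Iio hp hq he₀ hΦ hE h0 h1
  have hpp : (0 : ℝ) < p * (1 - p) := mul_pos hp0 (sub_pos.2 hp1)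
  constructor
  · intro hdiff
    -- the derivative equals both one-sided derivatives
    have hder := hdiff.hasDerivAt
    have hR' : HasDerivWithinAt Φ (deriv Φ p) (Set.Ioi p) p := hder.hasDerivWithinAt
    have hL' : HasDerivWithinAt Φ (deriv Φ p) (Set.Iio p) p := hder.hasDerivWithinAt
    have e1 : deriv Φ p = d * (wiredEdgeDensity d p q e₀ - p) / (p * (1 - p)) :=
      tendsto_nhds_unique ((hasDerivWithinAt_iff_tendsto_slope' (show p ∉ Set.Ioi p from lt_irrefl p)).1 hR')
        ((hasDerivWithinAt_iff_tendsto_slope' (show p ∉ Set.Ioi p from lt_irrefl p)).1 hR)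
    have e2 : deriv Φ p = d * (freeEdgeDensity d p q e₀ - p) / (p * (1 - p)) :=
      tendsto_nhds_unique ((hasDerivWithinAt_iff_tendsto_slope' (show p ∉ Set.Iio p from lt_irrefl p)).1 hL')
        ((hasDerivWithinAt_iff_tendsto_slope' (show p ∉ Set.Iio p from lt_irrefl p)).1 hL)
    rw [e1] at e2
    have hd0 : (d : ℝ) ≠ 0 := by exact_mod_cast hd.ne'
    have e3 := (div_left_inj' hpp.ne').1 e2
    have e4 := mul_left_cancel₀ hd0 e3
    linarith
  · intro heq
    rw [heq] at hL
    have h := (hL.Iic_of_Iio).union (hR.Ici_of_Ioi)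
    rw [Set.Iic_union_Ici, hasDerivWithinAt_univ] at h
    exact h.differentiableAt

/-- **Grimmett 2006, Thm. (4.63) (a) ⟺ (d): the pressure is differentiable at `p` iff there is a unique random-cluster measure,
`φ⁰_{p,q} = φ¹_{p,q}`** (via FO-07b `rcLimit_false_eq_rcLimit_true_iff_of_mem_edgeSet`: `φ⁰ = φ¹ ⟺ h⁰ = h¹`), under the hypotheses of
`hasDerivWithinAt_pressure_Ioi`. [cite: Grimmett2006, Thm. (4.63) ((a) ⟺ (d))] -/
theorem differentiableAt_pressure_iff_rcLimit_eq (hp : p ∈ Set.Ioo (0 : ℝ) 1) (hq : 1 ≤ q) (he₀ : e₀ ∈ (zdGraph d).edgeSet)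
    (hΦ : ∀ b : Bool, ∀ x ∈ Set.Ioo (0 : ℝ) 1, Tendsto (fun N : ℕ =>
      Real.log (rcPartitionFunction (finsetGraph (zdGraph d) (box d N)) x q (boxBC d b N)) / #(box d N)) atTop (𝓝 (Φ x)))
    (hE : Tendsto (fun N : ℕ => (#(finsetGraph (zdGraph d) (box d N)).edgeFinset : ℝ) / #(box d N)) atTop (𝓝 (d : ℝ)))
    (h0 : ∀ x ∈ Set.Ioo (0 : ℝ) 1, Tendsto (fun N : ℕ =>
      rcExpect (finsetGraph (zdGraph d) (box d N)) x q (boxBC d false N) (fun ω => (#ω : ℝ)) / #(box d N)) atTop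
        (𝓝 (d * freeEdgeDensity d x q e₀)))
    (h1 : ∀ x ∈ Set.Ioo (0 : ℝ) 1, Tendsto (fun N : ℕ =>
      rcExpect (finsetGraph (zdGraph d) (box d N)) x q (boxBC d true N) (fun ω => (#ω : ℝ)) / #(box d N)) atTop
        (𝓝 (d * wiredEdgeDensity d x q e₀))) :
    DifferentiableAt ℝ Φ p ↔ rcLimit d false p q = rcLimit d true p q := by
  rw [differentiableAt_pressure_iff_edgeDensity_eq hp hq he₀ hΦ hE h0 h1,
    rcLimit_false_eq_rcLimit_true_iff_of_mem_edgeSet ⟨hp.1.le, hp.2.le⟩ hq he₀]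

end Derivatives

end Summit.CriticalPhenomena.PercolationContinuityZ3.Theorems.FK
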